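import Mathlib
import Summits.AtomisticToContinuum.HydrodynamicLimit.Theorems.RelayRaceLocalityNearConstantShortTimeHLSolutionTests
import Summits.AtomisticToContinuum.HydrodynamicLimit.Theorems.RelayRaceLocalityNearConstantShortTimeHLDefectLinearity
import Summits.AtomisticToContinuum.HydrodynamicLimit.Theorems.DenseExcursion.Negative.AthermalScaling
import Literature.Analysis.FunctionSpaces.TorusSpaceTime
import Literature.Analysis.FunctionSpaces.TorusCalculusProofs
import HarnessLib

/-!
# Crux `NearConstantShortTimeHL` (stmt-AtomisticToContinuum-12502), line `small-tilt-domination`: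
# stubs `weightedTest_smooth`, `rowTest_admissible`, `weightedRowTest_admissible`

The tests fed to the closure K-stubs of the Grönwall assembly (lead c3, wave 3). Given a row
`f` jointly smooth on the half-open slab `[0, T') × 𝕋³` and a closed window `[s, s'] ⊆ [0, T')`:

* `weightedTest_smooth` — the time-weighted row `(r, y) ↦ (c - r) • f r y` is jointly smooth on
  `[s, s'] × 𝕋³`, with the product-rule one-sided time derivative
  `∂ₜ((c - r) • f) = -f + (c - r) • ∂ₜ f` (the last derivative taken within `[0, T')`);
* `rowTest_admissible` — if `‖f‖, ‖∂ₜ f‖, ‖∂ᵢ f‖ ≤ Λ` on the window, the `C¹`-normalised row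
  `Λ⁻¹ • f` is ADMISSIBLE: jointly smooth on `[s, s'] × 𝕋³` and of size `≤ 1` together with its
  first derivatives (time derivative within `[s, s']`);
* `weightedRowTest_admissible` — the same for the weighted row `(2Λ)⁻¹ • ((s' - r) • f r y)` on
  windows of length `s' - s ≤ 1` (`‖∂ₜ((s' - r) • f)‖ ≤ ‖f‖ + (s' - r)‖∂ₜ f‖ ≤ 2Λ`).

Route (folklore): restriction of joint smoothness to `[s, s'] ⊆ [0, T')`
(`Torus.IsSmoothSpaceTimeOn.mono`), algebraic closure (`.smul`, `.const_smul`), the weight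
`(r, y) ↦ c - r` being the smooth function `p ↦ c - p.1` of the space–time variable; the product
rule `HasDerivWithinAt.smul` for the slice `τ ↦ f τ x` (differentiable within `[0, T') ⊇ [s, s']`,
`Torus.IsSmoothSpaceTimeOn.hasDerivWithinAt_slice`) on the set of unique differentiability
`[s, s']`; unconditional homogeneity of `Torus.timeDerivWithin` (`we_timeDerivWithin_const_smul`)
and of `Torus.partialDeriv` (`DenseExcursionAthermalScaling.partialDeriv_const_smul`); and the
identification `timeDerivWithin_Icc_eq_of_isSmoothSpaceTimeOn` of the time derivatives within
`[s, s']` and within `[0, T')`.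

No definitions, no named facts.
-/

noncomputable section

namespace Summit.AtomisticToContinuum.HydrodynamicLimit.Theorems.NearConstantShortTimeHL

open scoped BigOperators ENNReal
open MeasureTheory Set Filter
open Literature.MathematicalPhysics.KineticTheory Literature.Analysis.FluidPDE Literature.Analysis.FunctionSpaces

/-! ### The affine time weight -/

/-- The affine time weight `(r, y) ↦ c - r` is jointly smooth on every time set (its space–time
lift is `p ↦ c - p.1`). [folklore] -/
theorem xe_isSmoothSpaceTimeOn_weight (c : ℝ) (S : Set ℝ) :
    Torus.IsSmoothSpaceTimeOn S (fun (r : ℝ) (_ : T3) => c - r) :=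
  Torus.isSmoothSpaceTimeOn_of_contDiff
    (show ContDiff ℝ ((⊤ : ℕ∞) : WithTop ℕ∞) (fun p : ℝ × EuclideanSpace ℝ (Fin 3) => c - p.1) from
      contDiff_const.sub contDiff_fst) S

/-- The affine time weight `τ ↦ c - τ` has derivative `-1` within every set. [folklore] -/
theorem xe_hasDerivWithinAt_weight (c : ℝ) (S : Set ℝ) (r : ℝ) :
    HasDerivWithinAt (fun τ : ℝ => c - τ) (-1) S r :=
  (hasDerivWithinAt_id (x := r) (s := S)).const_sub c

/-- Normalisation: `‖v‖ ≤ Λ`, `0 < Λ` give `‖Λ⁻¹ • v‖ ≤ 1`. [folklore] -/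
theorem xe_norm_inv_smul_le_one {F' : Type*} [NormedAddCommGroup F'] [NormedSpace ℝ F']
    {Λ : ℝ} (hΛ : 0 < Λ) {v : F'} (hv : ‖v‖ ≤ Λ) : ‖Λ⁻¹ • v‖ ≤ 1 := by
  rw [norm_smul, Real.norm_eq_abs, abs_of_nonneg (inv_nonneg.2 hΛ.le)]
  calc Λ⁻¹ * ‖v‖ ≤ Λ⁻¹ * Λ := mul_le_mul_of_nonneg_left hv (inv_nonneg.2 hΛ.le)
    _ = 1 := inv_mul_cancel₀ hΛ.ne'

/-- A weight `w ∈ [0, 1]` does not increase norms: `‖w • v‖ ≤ Λ` if `‖v‖ ≤ Λ`. [folklore] -/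
theorem xe_norm_weight_smul_le {F' : Type*} [NormedAddCommGroup F'] [NormedSpace ℝ F']
    {w Λ : ℝ} (hw0 : 0 ≤ w) (hw1 : w ≤ 1) {v : F'} (hv : ‖v‖ ≤ Λ) : ‖w • v‖ ≤ Λ := by
  rw [norm_smul, Real.norm_eq_abs, abs_of_nonneg hw0]
  calc w * ‖v‖ ≤ 1 * ‖v‖ := mul_le_mul_of_nonneg_right hw1 (norm_nonneg _)
    _ = ‖v‖ := one_mul _
    _ ≤ Λ := hv

/-! ### The time-weighted row -/

/-- **Smoothness and product rule for the time-weighted row.** For `f` jointly smooth on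
`[0, T') × 𝕋³` and a window `[s, s'] ⊆ [0, T')`, the weighted row `(r, y) ↦ (c - r) • f r y` is
jointly smooth on `[s, s'] × 𝕋³` and `∂ₜ((c - r) • f)(r, x) = -f r x + (c - r) • ∂ₜ f (r, x)`, the
time derivative of the weighted row being taken within `[s, s']` and that of `f` within `[0, T')`. [folklore] -/
theorem weightedTest_smooth : ∀ {F' : Type*} [NormedAddCommGroup F'] [NormedSpace ℝ F'] {T' s s' : ℝ} (c : ℝ) {f : ℝ → T3 → F'}, Torus.IsSmoothSpaceTimeOn (Set.Ico 0 T') f → 0 ≤ s → s < s' → s' < T' → Torus.IsSmoothSpaceTimeOn (Set.Icc s s') (fun r y => (c - r) • f r y) ∧ ∀ r ∈ Set.Icc s s', ∀ x : T3, Torus.timeDerivWithin (Set.Icc s s') (fun r y => (c - r) • f r y) r x = -(f r x) + (c - r) • Torus.timeDerivWithin (Set.Ico 0 T') f r x := by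
  intro F' _ _ T' s s' c f hf hs hss' hs'
  have hsub : Set.Icc s s' ⊆ Set.Ico 0 T' := fun τ hτ => ⟨hs.trans hτ.1, hτ.2.trans_lt hs'⟩
  refine ⟨(xe_isSmoothSpaceTimeOn_weight c _).smul (hf.mono hsub), fun r hr x => ?_⟩
  have h2 : HasDerivWithinAt (fun τ => f τ x) (Torus.timeDerivWithin (Set.Ico 0 T') f r x)
      (Set.Icc s s') r :=
    (hf.hasDerivWithinAt_slice (hsub hr) x).mono hsub
  have h : HasDerivWithinAt (fun τ => (c - τ) • f τ x)
      ((c - r) • Torus.timeDerivWithin (Set.Ico 0 T') f r x + (-1 : ℝ) • f r x) (Set.Icc s s') r :=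
    (xe_hasDerivWithinAt_weight c _ r).smul h2
  have hd : Torus.timeDerivWithin (Set.Icc s s') (fun r y => (c - r) • f r y) r x =
      (c - r) • Torus.timeDerivWithin (Set.Ico 0 T') f r x + (-1 : ℝ) • f r x :=
    h.derivWithin (uniqueDiffOn_Icc hss' r hr)
  rw [hd, neg_one_smul, add_comm]

/-! ### Admissibility of the normalised rows -/

/-- **Admissibility of the `C¹`-normalised row.** If `‖f‖, ‖∂ₜ f‖, ‖∂ᵢ f‖ ≤ Λ` on the window
`[s, s'] ⊆ [0, T')` (`0 < Λ`), then `Λ⁻¹ • f` is jointly smooth on `[s, s'] × 𝕋³` and has size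
`≤ 1` together with its time derivative within `[s, s']` and its spatial partial derivatives. [folklore] -/
theorem rowTest_admissible : ∀ {F' : Type*} [NormedAddCommGroup F'] [NormedSpace ℝ F'] {T' s s' : ℝ} {f : ℝ → T3 → F'}, Torus.IsSmoothSpaceTimeOn (Set.Ico 0 T') f → 0 ≤ s → s < s' → s' < T' → ∀ {Λ : ℝ}, 0 < Λ → (∀ r ∈ Set.Icc s s', ∀ x, ‖f r x‖ ≤ Λ ∧ ‖Torus.timeDerivWithin (Set.Ico 0 T') f r x‖ ≤ Λ ∧ ∀ i, ‖Torus.partialDeriv i (f r) x‖ ≤ Λ) → Torus.IsSmoothSpaceTimeOn (Set.Icc s s') (fun r y => Λ⁻¹ • f r y) ∧ ∀ r ∈ Set.Icc s s', ∀ x, ‖(fun r y => Λ⁻¹ • f r y) r x‖ ≤ 1 ∧ ‖Torus.timeDerivWithin (Set.Icc s s') (fun r y => Λ⁻¹ • f r y) r x‖ ≤ 1 ∧ ∀ i, ‖Torus.partialDeriv i ((fun r y => Λ⁻¹ • f r y) r) x‖ ≤ 1 := by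
  intro F' _ _ T' s s' f hf hs hss' hs' Λ hΛ hB
  have hsub : Set.Icc s s' ⊆ Set.Ico 0 T' := fun τ hτ => ⟨hs.trans hτ.1, hτ.2.trans_lt hs'⟩
  refine ⟨(hf.mono hsub).const_smul Λ⁻¹, fun r hr x => ⟨?_, ?_, fun i => ?_⟩⟩
  · exact xe_norm_inv_smul_le_one hΛ (hB r hr x).1
  · rw [we_timeDerivWithin_const_smul,
      timeDerivWithin_Icc_eq_of_isSmoothSpaceTimeOn hf hs hss' hs' hr x]
    exact xe_norm_inv_smul_le_one hΛ (hB r hr x).2.1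
  · show ‖Torus.partialDeriv i (fun y => Λ⁻¹ • f r y) x‖ ≤ 1
    rw [DenseExcursionAthermalScaling.partialDeriv_const_smul]
    exact xe_norm_inv_smul_le_one hΛ ((hB r hr x).2.2 i)

/-- **Admissibility of the `C¹`-normalised weighted row.** On a window `[s, s'] ⊆ [0, T')` of
length `s' - s ≤ 1`, if `‖f‖, ‖∂ₜ f‖, ‖∂ᵢ f‖ ≤ Λ` (`0 < Λ`), then
`(2Λ)⁻¹ • ((s' - r) • f r y)` is jointly smooth on `[s, s'] × 𝕋³` and has size `≤ 1` together
with its time derivative within `[s, s']` (`‖∂ₜ((s' - r) • f)‖ ≤ ‖f‖ + (s' - r)‖∂ₜ f‖ ≤ 2Λ`)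
and its spatial partial derivatives. [folklore] -/
theorem weightedRowTest_admissible : ∀ {F' : Type*} [NormedAddCommGroup F'] [NormedSpace ℝ F'] {T' s s' : ℝ} {f : ℝ → T3 → F'}, Torus.IsSmoothSpaceTimeOn (Set.Ico 0 T') f → 0 ≤ s → s < s' → s' < T' → s' - s ≤ 1 → ∀ {Λ : ℝ}, 0 < Λ → (∀ r ∈ Set.Icc s s', ∀ x, ‖f r x‖ ≤ Λ ∧ ‖Torus.timeDerivWithin (Set.Ico 0 T') f r x‖ ≤ Λ ∧ ∀ i, ‖Torus.partialDeriv i (f r) x‖ ≤ Λ) → Torus.IsSmoothSpaceTimeOn (Set.Icc s s') (fun r y => (2 * Λ)⁻¹ • ((s' - r) • f r y)) ∧ ∀ r ∈ Set.Icc s s', ∀ x, ‖(fun r y => (2 * Λ)⁻¹ • ((s' - r) • f r y)) r x‖ ≤ 1 ∧ ‖Torus.timeDerivWithin (Set.Icc s s') (fun r y => (2 * Λ)⁻¹ • ((s' - r) • f r y)) r x‖ ≤ 1 ∧ ∀ i, ‖Torus.partialDeriv i ((fun r y => (2 * Λ)⁻¹ • ((s' - r) • f r y)) r) x‖ ≤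 1 := by
  intro F' _ _ T' s s' f hf hs hss' hs' hlen Λ hΛ hB
  obtain ⟨hg, hgd⟩ := weightedTest_smooth s' hf hs hss' hs'
  have h2Λ : 0 < 2 * Λ := by positivity
  have hΛ2 : Λ ≤ 2 * Λ := by linarith
  refine ⟨hg.const_smul (2 * Λ)⁻¹, fun r hr x => ?_⟩
  have hw0 : 0 ≤ s' - r := sub_nonneg.2 hr.2
  have hw1 : s' - r ≤ 1 := by linarith [hr.1]
  obtain ⟨hf0, hft, hfx⟩ := hB r hr x
  refine ⟨xe_norm_inv_smul_le_one h2Λ ((xe_norm_weight_smul_le hw0 hw1 hf0).trans hΛ2), ?_,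
    fun i => ?_⟩
  · rw [we_timeDerivWithin_const_smul (Set.Icc s s') (2 * Λ)⁻¹ (fun r y => (s' - r) • f r y) r x,
      hgd r hr x]
    refine xe_norm_inv_smul_le_one h2Λ ?_
    calc ‖-(f r x) + (s' - r) • Torus.timeDerivWithin (Set.Ico 0 T') f r x‖
        ≤ ‖-(f r x)‖ + ‖(s' - r) • Torus.timeDerivWithin (Set.Ico 0 T') f r x‖ := norm_add_le _ _
      _ ≤ Λ + Λ := add_le_add (by rw [norm_neg]; exact hf0) (xe_norm_weight_smul_le hw0 hw1 hft)
      _ = 2 * Λ := by ring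
  · show ‖Torus.partialDeriv i (fun y => (2 * Λ)⁻¹ • ((s' - r) • f r y)) x‖ ≤ 1
    rw [DenseExcursionAthermalScaling.partialDeriv_const_smul,
      DenseExcursionAthermalScaling.partialDeriv_const_smul (s' - r) (f r)]
    exact xe_norm_inv_smul_le_one h2Λ ((xe_norm_weight_smul_le hw0 hw1 (hfx i)).trans hΛ2)

end Summit.AtomisticToContinuum.HydrodynamicLimit.Theorems.NearConstantShortTimeHL

end
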